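import Literature.AlgebraicGeometry.Resolution.Dehomogenization
import Mathlib.RingTheory.MvPolynomial.Homogeneous
import HarnessLib

/-!
# Forms whose dehomogenization is `c (T − a)^μ` are `c (Y_l − a Y_j)^μ` (CoP1, Lemma 4.3 (2))

Topic: `Literature/AlgebraicGeometry/Resolution`. The homogeneous reformulation of the
one-variable computation of [CoP1] = Cossart–Piltant, J. Algebra 320 (2008), Lemma 4.3 (2)
(`NearPointsOneVariable.lean`): with `in_x f = F(Y_1, Y_2)` ((10)) and
`y_1^{-μ} f ≡ F(1, y_2′)` ((11)), if `F(1, T) = c (T − a)^μ` then `F = c (Y_2 − a Y_1)^μ`. PROVED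
for forms in any finite set of variables (dehomogenization is injective on forms,
`Dehomogenization.lean`):

* `dehomogenize_X_sub_C_mul_X_pow` — `(Y_l − a Y_j)^μ (Y_j := 1) = (T_l − a)^μ`;
* `eq_C_mul_X_sub_C_mul_X_pow_of_dehomogenize_eq` — **a form `F` of degree `μ` with
  `F(Y_j := 1) = c (T_l − a)^μ` equals `c (Y_l − a Y_j)^μ`.**

## Sources

* V. Cossart, O. Piltant, J. Algebra 320 (2008), Lemma 4.3 (2) with (10)–(11), p. 8.
  [CossartPiltant2008]
-/

noncomputable section

open MvPolynomial

namespace Literature.AlgebraicGeometry.Resolution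

universe u

variable {R : Type u} [CommRing R] {σ : Type*} [DecidableEq σ] (j : σ) {l : σ} (hl : l ≠ j)

omit [DecidableEq σ] in
/-- The form `(Y_l − a Y_j)^μ` is homogeneous of degree `μ`. [folklore] -/
theorem isHomogeneous_C_mul_X_sub_C_mul_X_pow (c a : R) (μ : ℕ) :
    (C c * (X l - C a * X j) ^ μ : MvPolynomial σ R).IsHomogeneous μ := by
  have h1 : (X l - C a * X j : MvPolynomial σ R).IsHomogeneous 1 :=
    (isHomogeneous_X R l).sub ((isHomogeneous_X R j).C_mul a)
  simpa using (isHomogeneous_C σ c).mul (h1.pow μ)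

include hl in
/-- **`(c (Y_l − a Y_j)^μ)(Y_j := 1) = c (T_l − a)^μ`.** [folklore] -/
theorem dehomogenize_C_mul_X_sub_C_mul_X_pow (c a : R) (μ : ℕ) :
    dehomogenize j (C c * (X l - C a * X j) ^ μ : MvPolynomial σ R) =
      C c * (X ⟨l, hl⟩ - C a) ^ μ := by
  rw [map_mul, map_pow, map_sub, map_mul, MvPolynomial.algHom_C, MvPolynomial.algHom_C,
    MvPolynomial.algebraMap_eq, MvPolynomial.aeval_X, MvPolynomial.aeval_X, killVar_of_ne j hl,
    killVar_self, mul_one]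

include hl in
/-- **[CoP1] Lemma 4.3 (2), homogeneous form: a form `F` of degree `μ` in the `Y`'s whose
dehomogenization `F(Y_j := 1)` is `c (T_l − a)^μ` is `c (Y_l − a Y_j)^μ`** (dehomogenization is
injective on forms of a fixed degree). [cite: CossartPiltant2008, Lemma 4.3 (2)] -/
theorem eq_C_mul_X_sub_C_mul_X_pow_of_dehomogenize_eq {F : MvPolynomial σ R} {μ : ℕ}
    (hF : F.IsHomogeneous μ) {c a : R}
    (h : dehomogenize j F = C c * (X ⟨l, hl⟩ - C a) ^ μ) :
    F = C c * (X l - C a * X j) ^ μ := by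
  by_contra hne
  have hsub : (F - C c * (X l - C a * X j) ^ μ).IsHomogeneous μ :=
    hF.sub (isHomogeneous_C_mul_X_sub_C_mul_X_pow j c a μ)
  have h0 := dehomogenize_ne_zero_of_isHomogeneous j hsub (sub_ne_zero.mpr hne)
  apply h0
  rw [map_sub, h, dehomogenize_C_mul_X_sub_C_mul_X_pow j hl, sub_self]

end Literature.AlgebraicGeometry.Resolution

end
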